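import Literature.AnabelianGeometry.EtaleTheta.Discharge.Sec5ThetaRootDivisorsFirstForm
import Literature.AnabelianGeometry.EtaleTheta.Discharge.Sec5OfQuotientTemperoidRootDataKummer
import Literature.AnabelianGeometry.EtaleTheta.Discharge.Sec5OfQuotientTemperoidDataFirstForm
import Literature.AnabelianGeometry.EtaleTheta.Discharge.Sec4Prop42iiiThetaTwistTowerSmallIndex
import Literature.AnabelianGeometry.EtaleTheta.Discharge.Sec4NestedRootFixednessThetaTwistTower
import Literature.AnabelianGeometry.EtaleTheta.Discharge.Sec5ThetaStubLiftOfSettingPin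
import Literature.AnabelianGeometry.EtaleTheta.ThetaTwistTowerThetaCoordinate
import HarnessLib

/-!
# [EtTh] §5 — THE FIRST §5 DATUM OF RECORD, PRINT'S FIRST FORM: the bi-Kummer `l·N`-th root of `Θ̈`'s right fraction-pair on `A_⊙` at the `Ÿ`-anchor of the small-index tower model — NO root binder, NO divisor binder, NO `hH` binder — and AT THE GENUINE `Π^tp_X̲̲` of a `ThetaSetting` (Prop. 5.2 (i) p.324, §5 pp.330–331 (PDF pp.98, 104–105))

S. Mochizuki, *The étale theta function and its Frobenioid-theoretic manifestations*, Publ. RIMS **45** (2009) [MochizukiEtTh2009],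
Prop. 5.2 (i) p.324 (PDF p.98): «`(s_{l·N}, τ_{l·N})` constitutes an `l·N`-th root of a right fraction-pair [cf. Proposition 4.2, (iii)]
of … the theta function `Θ̈`» (FIRST form; the `N`-th root of an `l`-th root «[cf. Remark 4.3.2]» is the SECOND form); (iii): «the Kummer
class determined by the bi-Kummer `l·N`-th root … the reduction modulo `l·N` of `η̈^Θ` relative to `μ_{l·N}(−) ≅ Δ_Θ ⊗ ℤ/l·N`»; §5
pp.330–331 (PDF pp.104–105) (`A_⊙`, `Θ̈ ∈ O^×(A_⊙^birat)`, `A_N → B_N`, `σ`, `Π^tp_X ↠ Aut_D(B_N^bs)`, `(l·Δ_Θ)_{B_N}`); Def. 4.1 (iii)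
p.313 (PDF p.87) («`f` FIXED by the natural action of `H_A`»); S. Mochizuki, *The geometry of Frobenioids I* (2008) [MochizukiFrdI2008],
Thm. 5.2 p.100.  [cite: MochizukiEtTh2009, Prop 5.2 (i) p.324 (PDF p.98)]
PAGE CONVENTION for [EtTh]: «printed N (PDF p.M)», N = M + 226.

abc-iut cell, layer L2 = [EtTh], seat abc-iut-L2-t4 (gen 10; §5 junction lineage), KEY «JUNCTION ASSEMBLY — plan/L2/SUBDAG-EtTh-JUNCTION
build-order STEP (5)», FORM RULING abc-iut-L2-lead R1374 / R1381 / R1385 (FINDING F-L2d2g8-2 «NESTED-R FIXEDNESS», abc-iut-L2-d2;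
F-L2t3g10-3 «TWIN-FACTS», abc-iut-L2-t3): the S-anchored NESTED binder `R : S.NthRoot Rl.root Rl.pair N` of the frozen constructor is an
EMPTY type at every tower socket (abc-iut-L2-d2's kernel witness `ThetaTwistTowerTempered.isEmpty_nthRoot_nested_theta`, p518033 — Def. 4.1
(iii)'s «fixed by `H_A`» fails for the pulled-back `l`-th root), so the datum of record is typed on PRINT'S FIRST FORM: ONE root of order
`l·N` of `Θ̈`'s own pair on `A_⊙`, the §2 datum `T` read at order `l·N`.  This file SUPERSEDES the nested-binder assemblies of this seat
(`Sec5FirstDatumThetaTwistTower` p513309 / `…SmallIndex` — vacuous in their `Rt` at the carriers of record) FOR THE COUNT; nothing landed is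
edited.  Consumed BY NAME: abc-iut-L2-t3's common core `ThetaFrobenioid.ofQuotientTemperoidRootData` (p517100) + `…Kummer` (Prop. 4.3 (iii)
root-generic) — `firstDatumFF` below IS abc-iut-L2-t3's thin instance `ofQuotientTemperoidDataFirstForm` at these arguments (both unfold to the core;
`Discharge/Sec5OfQuotientTemperoidDataFirstForm`), `settingSmallYdd` / `hH_settingSmallYdd` / `hypotheses_temperedFrobenioidSmall` (p504077), `nonempty_nthRoot_settingSmallYdd`
(p512762); abc-iut-L2-d2's `thetaProperUnitYdd` / `thetaProperFractionPairYdd` (p514011), FIRST-FORM divisor twins `hinvc_thetaProperRootYdd` /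
`hinvp_thetaProperRootYdd` (p519441); abc-iut-L2-t4 gen 9 `ThetaCoord.thetaStub` (p504128), gen 10 `ThetaSubquotient.ofSettingSubLift` (p514054);
abc-iut-L2-t4 gen 5 `C.temperedArithmeticGroup` (p436226); abc-iut-L2-t8 `C.thetaEnvData`.
* §A GENERIC (`X : TemperedArithmeticGroup.{0} K`, continuous surjection `φ : Π^tp_X ↠ Compat₃′` DISPLAYED (junction S2, design-only socket
  R1257), §2 datum `T : ThetaEnvData (l·N)`, `ιX`, display clause `hY : φ₃ ∘ φ ∘ ιX = 1` on `Π^tp_Ÿ`, `Q` a PARAMETER): `ThetaProperRootYdd`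
  (type abbreviation), **`firstDatumFF R S X φ hφ T ιX hY Q Rt K' constEmb inj`** for ANY root `Rt` of order `l·N` — `hinvc`/`hinvp`/`hH`
  THEOREMS; laws `StrvSection` / `SgpCapSpec` / `SgpCupSpec` / `SgpCapSection` / `AutAmpleBN` / `SgpCupSection` UNCONDITIONAL; **Prop. 4.3 (iii)
  `BiKummerDifferenceMem` a THEOREM** (abc-iut-L2-t3's root-generic proof at the identity dictionary) ⇒ **`Facts ⟸ ConstantsActByCyclotome`
  (Lemma 5.8's arithmetic step) ALONE**; rfl dictionary; **`thetaProperRootFF` := THE `l·N`-th root of record** (`Classical.choice` from p512762)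
  ⇒ `firstDatumOfRecord R S X φ hφ T ιX hY Q K' constEmb inj` with **NO root binder**.
* §B AT THE GENUINE `Π^tp_X̲̲` of a `ThetaSetting` (`X := C.temperedArithmeticGroup e`, `T := C.thetaEnvData μ hC hS` at order `l·N`, any
  `ιX` — `refl` admissible): the five laws with `Q := ThetaCoord.thetaStub l` and with `Q :=` the Setting's own `(l·Δ_Θ)` read on the model's
  base; ENTRY `exists_thetaFrobenioid_firstForm_ofThetaSetting` — hypotheses EXACTLY {`φ` onto, `hY`, a constants datum}.
HONEST FRAMING / DISPLAYED AFTER THIS FILE: S2 (`φ` onto `Compat₃′` — design-only; the continuous-`φ` true shape is abc-iut-L2-t3's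
`settingClosureRange`, p510277/p513433), `hY`, D7 constants `(K', constEmb, inj)` ○ LABELLED «degenerate-or-absent at this countable carrier
(abc-iut-L2-t11 p499346 / R1155 J′); non-degenerate = abc-iut-L2-d3's base-field hull» and `hK` (never instantiated here, NOT counted), and —
for the Setting-`Q` variant — `hker`; the carrier is OUR class-(b) combinatorial DESIGN tower, NOT the tempered Frobenioid of a Tate curve;
what this COUNTS for is the chair's ruling (R1072 / R1385 pre-adopted reading), not claimed here.  [EtTh]/[FrdI] are refereed prerequisite
papers; nothing here bears on, or takes a side on, the disputed [IUTchIII] Cor. 3.12; nothing here asserts abc proved or refuted; typed ≠ proved.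
-/

noncomputable section

namespace Literature.AnabelianGeometry.EtaleTheta

open CategoryTheory Opposite Function Literature.AlgebraicGeometry.Frobenioids Literature.AlgebraicGeometry.Frobenioids.QuasiTemperoid
  Literature.AnabelianGeometry.SemiGraphs Literature.AnabelianGeometry.SemiGraphs.GaloisObjects LogDivisorModel
  LogDivisorModel.GaloisAction LogDivisorTower TateTowerKummerTwistRShear LogDivisorModel.TateTowerThetaTwist

namespace ThetaTwistTowerSmallIndex

open ThetaTwistTowerTempered

/-! ## §A The first-form §5 datum at the `Ÿ`-anchor of `settingSmallYdd` (junction items D1–D8) -/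

section Generic

variable (R S : ((ConnectedPart (BTemp (Compat 3 thetaShear)))ᵒᵖ ⥤ CommMonCat.{0}) → Prop)
  {K : Type} [Field K] (X : SemiGraphs.TemperedArithmeticGroup.{0} K) (φ : X.Pi →ₜ* Compat 3 thetaShear)
  (hφ : Function.Surjective φ) {lv N : ℕ+} (T : ThetaEnvData.{0} (lv * N)) (ιX : T.PiX ≃ₜ* X.Pi)
  (hY : ∀ y : T.PiX, y ∈ T.PiYdd → φ₃ (φ (ιX y)) = 1)

/-- **The type of roots `(A_M, B_M, s^⊓_M, s^⊔_M)` of order `M` of the theta function's fraction-pair `(Θ̈; s′, s″)` at the `Ÿ`-anchor**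
(reducible type abbreviation, elaborated once — see the ELABORATION NOTE). [cite: MochizukiEtTh2009, §5 p.330 (PDF p.104); Prop 4.2 (iii) p.314 (PDF p.88)] -/
abbrev ThetaProperRootYdd (M : ℕ+)
    (pullFrac : ∀ {A A' : (settingSmallYdd R S X φ hφ (fun _ _ _ => True) T ιX).C} (_ : A' ⟶ A),
      (settingSmallYdd R S X φ hφ (fun _ _ _ => True) T ιX).biratUnits A →
        (settingSmallYdd R S X φ hφ (fun _ _ _ => True) T ιX).biratUnits A') :=
  (settingSmallYdd R S X φ hφ (fun _ _ _ => True) T ιX).NthRoot (thetaProperUnitYdd R S X φ hφ (fun _ _ _ => True) T ιX hY)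
    (thetaProperFractionPairYdd R S X φ hφ (fun _ _ _ => True) T ιX hY) M pullFrac

variable (Q : FrobenioidTheta.ThetaSubquotientStub.{0} (ConnectedPart (BTemp (Compat 3 thetaShear))))
  {pullFrac : ∀ {A A' : (settingSmallYdd R S X φ hφ (fun _ _ _ => True) T ιX).C} (_ : A' ⟶ A),
    (settingSmallYdd R S X φ hφ (fun _ _ _ => True) T ιX).biratUnits A →
      (settingSmallYdd R S X φ hφ (fun _ _ _ => True) T ιX).biratUnits A'}
  (Rt : ThetaProperRootYdd R S X φ hφ T ιX hY (lv * N) pullFrac)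
  (odd_l : Odd (lv : ℕ)) (K' : Type) [Field K'] (constEmb : K'ˣ →* (temperedFrobenioidSmall R S).biratUnitsModel Rt.BN)
  (constEmb_injective : Injective constEmb)

-- ELABORATION NOTE (as in this seat's `Sec5FirstDatumThetaTwistTowerSmallIndex`): at the `def`-chain carrier `settingSmallYdd` every defeq
-- against the generic constructor's binders unfolds the tower's level function ≈ 8·10⁴ times; remedy = (i) every implicit of the core passed
-- explicitly, (ii) raised `maxHeartbeats` on the declarations so marked (400000–1600000; each meets the generic binders once), (iii) laws by first-order matching
-- against the unfolded `def` (underscore form), (iv) the root TYPE as the reducible abbreviation above.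
set_option maxHeartbeats 800000 in
/-- **THE FIRST §5 DATUM, PRINT'S FIRST FORM** (Prop. 5.2 (i) p.324; §5 pp.330–331): over `B^temp(Compat₃′)⁰` at the small-index tower
model, `Ÿ`-anchor `A_⊙ = (Compat₃′/φ(ιX(Π^tp_Ÿ)), 0)`, `Θ̈ = thetaProperUnitYdd`, its fraction-pair, ONE root `Rt` of order `l·N`
(`A_{l·N} → B_{l·N}`, `s^⊓`, `s^⊔`), §2 datum `T` at order `l·N`, `σ` CONSTRUCTED, `Π^tp_X ↠ Aut_D(B^bs)` from `φ`, `(l·Δ_Θ)_{(-)} := Q`;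
`hinvc` / `hinvp` / `hH` THEOREMS (abc-iut-L2-d2 p519441, abc-iut-L2-t3 p504077).  DISPLAYED: `φ` onto, `hY`, constants ○ (LABEL: not counted).
[cite: MochizukiEtTh2009, Prop 5.2 (i) p.324 (PDF p.98); §5 p.330–331 (PDF pp.104–105)] -/
def firstDatumFF :
    ThetaFrobenioid.{0} (settingSmallYdd R S X φ hφ (fun _ _ _ => True) T ιX).C (ConnectedPart (BTemp (Compat 3 thetaShear))) :=
  ThetaFrobenioid.ofQuotientTemperoidRootData (X := X) (hG := isTempered_compat₃') (φ := φ) (hφ := hφ)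
    (tf := temperedFrobenioidSmall R S) (hZ := rfl) (hP := hPSmall R S) (NH := fun _ _ _ => True)
    (A₀ := (temperedFrobenioidSmall R S).quotConnZeroObj isTempered_compat₃'
      (BiKummerSetting.yddImage X φ hφ T ιX (isOpen_yddImage_compat₃ X φ hφ T ιX)))
    (hA₀ := (temperedFrobenioidSmall R S).isFrobeniusTrivial_quotConnZeroObj isTempered_compat₃'
      (BiKummerSetting.yddImage X φ hφ T ιX (isOpen_yddImage_compat₃ X φ hφ T ιX)))
    (hA₀' := (temperedFrobenioidSmall R S).isGaloisObj_quotConnZeroObj_base isTempered_compat₃'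
      (BiKummerSetting.yddImage X φ hφ T ιX (isOpen_yddImage_compat₃ X φ hφ T ιX)))
    (pullFrac := pullFrac) (T := T) (R := Rt)
    (thetaProperUnitYdd R S X φ hφ (fun _ _ _ => True) T ιX hY) (hypotheses_temperedFrobenioidSmall R S) Q odd_l ιX K' constEmb
    constEmb_injective (hinvc_thetaProperRootYdd R S X (fun _ _ _ => True) φ hφ T ιX hY Rt)
    (hinvp_thetaProperRootYdd R S X (fun _ _ _ => True) φ hφ T ιX hY Rt)

/-- `Π^tp_X` of the datum is that of the §2 datum `T`. [cite: MochizukiEtTh2009, §5 p.331 (PDF p.105)] -/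
theorem firstDatumFF_PiX : (firstDatumFF R S X φ hφ T ιX hY Q Rt odd_l K' constEmb constEmb_injective).PiX = T.PiX := rfl

/-- `A_⊙` of the datum is the `Ÿ`-anchor of `settingSmallYdd`. [cite: MochizukiEtTh2009, §5 p.330 (PDF p.104)] -/
theorem firstDatumFF_Acirc : (firstDatumFF R S X φ hφ T ιX hY Q Rt odd_l K' constEmb constEmb_injective).Acirc =
    (settingSmallYdd R S X φ hφ (fun _ _ _ => True) T ιX).Aodot := rfl

/-- `Θ̈` of the datum is abc-iut-L2-d2's theta function at the `Ÿ`-anchor. [cite: MochizukiEtTh2009, §5 p.330 (PDF p.104)] -/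
theorem firstDatumFF_thetaFn : (firstDatumFF R S X φ hφ T ιX hY Q Rt odd_l K' constEmb constEmb_injective).thetaFn =
    thetaProperUnitYdd R S X φ hφ (fun _ _ _ => True) T ιX hY := rfl

/-- `A_N`, `B_N`, `s^⊓`, `s^⊔` of the datum are the root's. [cite: MochizukiEtTh2009, §5 p.330 (PDF p.104)] -/
theorem firstDatumFF_AN_BN_sCap_sCup :
    (firstDatumFF R S X φ hφ T ιX hY Q Rt odd_l K' constEmb constEmb_injective).AN = Rt.AN ∧
    (firstDatumFF R S X φ hφ T ιX hY Q Rt odd_l K' constEmb constEmb_injective).BN = Rt.BN ∧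
    (firstDatumFF R S X φ hφ T ιX hY Q Rt odd_l K' constEmb constEmb_injective).sCap = Rt.pair.num ∧
    (firstDatumFF R S X φ hφ T ιX hY Q Rt odd_l K' constEmb constEmb_injective).sCup = Rt.pair.den := ⟨rfl, rfl, rfl, rfl⟩

/-- `(l·Δ_Θ)_E` of the datum is the supplied stub `Q`. [cite: MochizukiEtTh2009, §5 p.327 (PDF p.101)] -/
theorem firstDatumFF_lDelta (E : ConnectedPart (BTemp (Compat 3 thetaShear))) :
    (firstDatumFF R S X φ hφ T ιX hY Q Rt odd_l K' constEmb constEmb_injective).lDelta E = Q.lDelta E := rfl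

/-- `l`, `N`, `K` of the datum: prime `l = lv`, Kummer order `l·N`, constants `K'`. [cite: MochizukiEtTh2009, §5 p.326 (PDF p.100)] -/
theorem firstDatumFF_l_N_K : (firstDatumFF R S X φ hφ T ιX hY Q Rt odd_l K' constEmb constEmb_injective).l = lv ∧
    (firstDatumFF R S X φ hφ T ιX hY Q Rt odd_l K' constEmb constEmb_injective).N = lv * N ∧
    (firstDatumFF R S X φ hφ T ιX hY Q Rt odd_l K' constEmb constEmb_injective).K = K' := ⟨rfl, rfl, rfl⟩

/-- **`StrvSection` holds UNCONDITIONALLY.** [cite: MochizukiEtTh2009, §5 p.331 (PDF p.105)] -/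
theorem strvSection_firstDatumFF :
    (firstDatumFF R S X φ hφ T ιX hY Q Rt odd_l K' constEmb constEmb_injective).StrvSection :=
  ThetaFrobenioid.strvSection_ofQuotientTemperoidRootData _ _ _ _ _ _ _ _ _ _ _

/-- **`SgpCapSpec` holds.** [cite: MochizukiEtTh2009, §5 p.331 (PDF p.105)] -/
theorem sgpCapSpec_firstDatumFF :
    (firstDatumFF R S X φ hφ T ιX hY Q Rt odd_l K' constEmb constEmb_injective).SgpCapSpec :=
  ThetaFrobenioid.sgpCapSpec_ofQuotientTemperoidRootData _ _ _ _ _ _ _ _ _ _ _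

/-- **`SgpCupSpec` holds.** [cite: MochizukiEtTh2009, §5 p.331 (PDF p.105)] -/
theorem sgpCupSpec_firstDatumFF :
    (firstDatumFF R S X φ hφ T ιX hY Q Rt odd_l K' constEmb constEmb_injective).SgpCupSpec :=
  ThetaFrobenioid.sgpCupSpec_ofQuotientTemperoidRootData _ _ _ _ _ _ _ _ _ _ _

/-- **`SgpCapSection` holds.** [cite: MochizukiEtTh2009, §5 p.331 (PDF p.105)] -/
theorem sgpCapSection_firstDatumFF :
    (firstDatumFF R S X φ hφ T ιX hY Q Rt odd_l K' constEmb constEmb_injective).SgpCapSection :=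
  ThetaFrobenioid.sgpCapSection_ofQuotientTemperoidRootData _ _ _ _ _ _ _ _ _ _ _

/-- **`SgpCupSection` holds** (abc-iut-L2-t3's root-generic twin of this seat's gen-5 theorem). [cite: MochizukiEtTh2009, §5 p.331 (PDF p.105)] -/
theorem sgpCupSection_firstDatumFF :
    (firstDatumFF R S X φ hφ T ιX hY Q Rt odd_l K' constEmb constEmb_injective).SgpCupSection :=
  ThetaFrobenioid.sgpCupSection_ofQuotientTemperoidRootData _ _ _ _ _ _ _ _ _ _ _

/-- **`B_{l·N}` is Aut-ample.** [cite: MochizukiEtTh2009, §5 p.330 (PDF p.104)] -/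
theorem autAmpleBN_firstDatumFF :
    (firstDatumFF R S X φ hφ T ιX hY Q Rt odd_l K' constEmb constEmb_injective).AutAmpleBN :=
  ThetaFrobenioid.autAmpleBN_ofQuotientTemperoidRootData _ _ _ _ _ _ _ _ _ _ _

set_option maxHeartbeats 1600000 in -- the dictionary-law binders of the root-generic Prop. 4.3 (iii) meet the carrier (precedent:
-- abc-iut-L2-t3's `Sec5OfQuotientTemperoidRootDataKummer`, same budget for the same unfolding; ELABORATION NOTE)
/-- **Prop. 4.3 (iii) `BiKummerDifferenceMem` IS A THEOREM at the datum** (abc-iut-L2-t3's root-generic `biKummerDifferenceMem_ofQuotientTemperoidRootData`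
at the identity dictionary: `hH := hH_settingSmallYdd`, `toB := id`, the [FrdI] Thm. 5.2 (ii) laws by abc-iut-L2-t9's `coe_fracOfModel_mul_unit` /
`coe_biratAutModel_eq_pull`). [cite: MochizukiEtTh2009, Prop 4.3 (iii) p.317 (PDF p.91)] -/
theorem biKummerDifferenceMem_firstDatumFF :
    (firstDatumFF R S X φ hφ T ιX hY Q Rt odd_l K' constEmb constEmb_injective).BiKummerDifferenceMem :=
  ThetaFrobenioid.biKummerDifferenceMem_ofQuotientTemperoidRootData _ _ _ _ _ _ _ _ _ _ _
    (hH_settingSmallYdd R S X φ hφ (fun _ _ _ => True) T ιX) (fun _ => MonoidHom.id _)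
    (fun s' s'' _ _ _ => BiKummerSetting.coe_fracOfModel_mul_unit (temperedFrobenioidSmall R S)
      (RealifiedDivisorMonoids.ofRlfZWeak dmSmall hpfSmall).isUnit_BΛ s' s'')
    (fun e x => BiKummerSetting.coe_biratAutModel_eq_pull (temperedFrobenioidSmall R S) e x)

set_option maxHeartbeats 800000 in -- as above
/-- **`Facts` at the datum ⟸ `ConstantsActByCyclotome` (Lemma 5.8's arithmetic step) ALONE** — section property, defining relations,
Aut-ampleness, total epimorphicity AND Prop. 4.3 (iii) being THEOREMS here. [cite: MochizukiEtTh2009, §5 p.330–331 (PDF pp.104–105); Lem 5.8 p.331 (PDF p.105)] -/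
theorem facts_firstDatumFF
    (hK : (firstDatumFF R S X φ hφ T ιX hY Q Rt odd_l K' constEmb constEmb_injective).ConstantsActByCyclotome) :
    (firstDatumFF R S X φ hφ T ιX hY Q Rt odd_l K' constEmb constEmb_injective).Facts :=
  ThetaFrobenioid.facts_ofQuotientTemperoidRootData _ _ _ _ _ _ _ _ _ _ _
    (biKummerDifferenceMem_firstDatumFF R S X φ hφ T ιX hY Q Rt odd_l K' constEmb constEmb_injective) hK

/-! ### THE root of record: NO root binder -/

set_option maxHeartbeats 800000 in -- `Classical.choice` from Prop. 4.2 (iii) at the `def`-chain setting (ELABORATION NOTE)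
/-- **THE `l·N`-th root `(A_{l·N}, B_{l·N}, s^⊓, s^⊔)` of the theta function's fraction-pair OF RECORD** (Prop. 5.2 (i) FIRST form) — chosen
(`Classical.choice`) from abc-iut-L2-t3's Prop. 4.2 (iii) instance at the `Ÿ`-anchor (`nonempty_nthRoot_settingSmallYdd`, p512762),
`pullFrac := pullFracModel`. [cite: MochizukiEtTh2009, Prop 5.2 (i) p.324 (PDF p.98); Prop 4.2 (iii) p.314 (PDF p.88)] -/
def thetaProperRootFF : ThetaProperRootYdd R S X φ hφ T ιX hY (lv * N) (fun {_} {_} ψ x => (temperedFrobenioidSmall R S).pullFracModel ψ x) :=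
  (nonempty_nthRoot_settingSmallYdd R S X φ hφ T ιX (lv * N) _
    (thetaProperFractionPairYdd R S X φ hφ (fun _ _ _ => True) T ιX hY)).some

variable (constEmb₀ : K'ˣ →* (temperedFrobenioidSmall R S).biratUnitsModel (thetaProperRootFF R S X φ hφ T ιX hY).BN)
  (constEmb₀_injective : Injective constEmb₀)

set_option maxHeartbeats 400000 in
/-- **THE FIRST §5 DATUM OF RECORD** — `firstDatumFF` at THE root of record: NO root binder, NO divisor binder, NO `hH` binder; displayed:
`φ` onto, `hY`, constants ○. [cite: MochizukiEtTh2009, Prop 5.2 (i) p.324 (PDF p.98); §5 p.330–331 (PDF pp.104–105)] -/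
abbrev firstDatumOfRecord :
    ThetaFrobenioid.{0} (settingSmallYdd R S X φ hφ (fun _ _ _ => True) T ιX).C (ConnectedPart (BTemp (Compat 3 thetaShear))) :=
  firstDatumFF R S X φ hφ T ιX hY Q (pullFrac := fun {_} {_} ψ x => (temperedFrobenioidSmall R S).pullFracModel ψ x)
    (thetaProperRootFF R S X φ hφ T ιX hY) odd_l K' constEmb₀ constEmb₀_injective

set_option maxHeartbeats 800000 in -- six instantiations at the record root (ELABORATION NOTE)
/-- **The datum of record satisfies `StrvSection ∧ SgpCapSpec ∧ SgpCupSpec ∧ SgpCapSection ∧ AutAmpleBN ∧ BiKummerDifferenceMem`, NO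
hypothesis beyond `φ` onto, `hY` and the constants datum.** [cite: MochizukiEtTh2009, §5 p.330–331 (PDF pp.104–105)] -/
theorem laws_firstDatumOfRecord :
    (firstDatumOfRecord R S X φ hφ T ιX hY Q odd_l K' constEmb₀ constEmb₀_injective).StrvSection ∧
    (firstDatumOfRecord R S X φ hφ T ιX hY Q odd_l K' constEmb₀ constEmb₀_injective).SgpCapSpec ∧
    (firstDatumOfRecord R S X φ hφ T ιX hY Q odd_l K' constEmb₀ constEmb₀_injective).SgpCupSpec ∧
    (firstDatumOfRecord R S X φ hφ T ιX hY Q odd_l K' constEmb₀ constEmb₀_injective).SgpCapSection ∧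
    (firstDatumOfRecord R S X φ hφ T ιX hY Q odd_l K' constEmb₀ constEmb₀_injective).AutAmpleBN ∧
    (firstDatumOfRecord R S X φ hφ T ιX hY Q odd_l K' constEmb₀ constEmb₀_injective).BiKummerDifferenceMem :=
  ⟨strvSection_firstDatumFF R S X φ hφ T ιX hY Q (pullFrac := fun {_} {_} ψ x => (temperedFrobenioidSmall R S).pullFracModel ψ x)
      (thetaProperRootFF R S X φ hφ T ιX hY) odd_l K' constEmb₀ constEmb₀_injective,
    sgpCapSpec_firstDatumFF R S X φ hφ T ιX hY Q (pullFrac := fun {_} {_} ψ x => (temperedFrobenioidSmall R S).pullFracModel ψ x)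
      (thetaProperRootFF R S X φ hφ T ιX hY) odd_l K' constEmb₀ constEmb₀_injective,
    sgpCupSpec_firstDatumFF R S X φ hφ T ιX hY Q (pullFrac := fun {_} {_} ψ x => (temperedFrobenioidSmall R S).pullFracModel ψ x)
      (thetaProperRootFF R S X φ hφ T ιX hY) odd_l K' constEmb₀ constEmb₀_injective,
    sgpCapSection_firstDatumFF R S X φ hφ T ιX hY Q (pullFrac := fun {_} {_} ψ x => (temperedFrobenioidSmall R S).pullFracModel ψ x)
      (thetaProperRootFF R S X φ hφ T ιX hY) odd_l K' constEmb₀ constEmb₀_injective,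
    autAmpleBN_firstDatumFF R S X φ hφ T ιX hY Q (pullFrac := fun {_} {_} ψ x => (temperedFrobenioidSmall R S).pullFracModel ψ x)
      (thetaProperRootFF R S X φ hφ T ιX hY) odd_l K' constEmb₀ constEmb₀_injective,
    biKummerDifferenceMem_firstDatumFF R S X φ hφ T ιX hY Q (pullFrac := fun {_} {_} ψ x => (temperedFrobenioidSmall R S).pullFracModel ψ x)
      (thetaProperRootFF R S X φ hφ T ιX hY) odd_l K' constEmb₀ constEmb₀_injective⟩

end Generic

/-! ## §B AT THE GENUINE `Π^tp_X̲̲` of a `ThetaSetting` (junction items S1 / D4 CONSTRUCTED) -/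

section OfThetaSetting

variable (R S : ((ConnectedPart (BTemp (Compat 3 thetaShear)))ᵒᵖ ⥤ CommMonCat.{0}) → Prop)
  {p : ℕ} [Fact p.Prime] {D : ThetaSetting p} {Eθ : D.EtaleThetaData} {l : ℕ} (C : Eθ.DoubleUnderline l)
  (e : D.toTemperedCurve.GroupLevelData) {lv N : ℕ+} (μ : D.CyclotomeMod l (lv * N)) (hC : D.Compat) (hS : D.Sec2Hyps)
  (φ : (C.temperedArithmeticGroup e).Pi →ₜ* Compat 3 thetaShear) (hφ : Function.Surjective φ)
  (ιX : (C.thetaEnvData μ hC hS).PiX ≃ₜ* (C.temperedArithmeticGroup e).Pi)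
  (hY : ∀ y : (C.thetaEnvData μ hC hS).PiX, y ∈ (C.thetaEnvData μ hC hS).PiYdd → φ₃ (φ (ιX y)) = 1)
  (odd_l : Odd (lv : ℕ)) (K' : Type) [Field K']
  (constEmb₀ : K'ˣ →* (temperedFrobenioidSmall R S).biratUnitsModel
    (thetaProperRootFF R S (C.temperedArithmeticGroup e) φ hφ (C.thetaEnvData μ hC hS) ιX hY).BN)
  (constEmb₀_injective : Injective constEmb₀)

set_option maxHeartbeats 400000 in -- re-elaboration of the root-typed binders (ELABORATION NOTE)
/-- **THE FIRST §5 DATUM OF RECORD AT THE GENUINE `Π^tp_X̲̲ = C.Huu` OF A `ThetaSetting`** (abc-iut-L2-t4's `X := C.temperedArithmeticGroup e`,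
abc-iut-L2-t8's `T := C.thetaEnvData μ hC hS` at order `l·N`, any identification `ιX` — `refl` admissible since both groups are `C.Huu` —, the
model's `Θ̈`-coordinate stub as `(l·Δ_Θ)_{(-)}`): the six laws, NO hypothesis beyond `φ` onto, `hY` on the Setting's own `Π^tp_Ÿ̲̲` and the
constants datum. [cite: MochizukiEtTh2009, §5 p.322 (PDF p.96); p.330–331 (PDF pp.104–105)] -/
theorem laws_firstDatumOfRecord_ofThetaSetting_thetaStub :
    (firstDatumOfRecord R S (C.temperedArithmeticGroup e) φ hφ (C.thetaEnvData μ hC hS) ιX hY (ThetaCoord.thetaStub (lv : ℕ)) odd_l K'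
        constEmb₀ constEmb₀_injective).StrvSection ∧
    (firstDatumOfRecord R S (C.temperedArithmeticGroup e) φ hφ (C.thetaEnvData μ hC hS) ιX hY (ThetaCoord.thetaStub (lv : ℕ)) odd_l K'
        constEmb₀ constEmb₀_injective).SgpCapSpec ∧
    (firstDatumOfRecord R S (C.temperedArithmeticGroup e) φ hφ (C.thetaEnvData μ hC hS) ιX hY (ThetaCoord.thetaStub (lv : ℕ)) odd_l K'
        constEmb₀ constEmb₀_injective).SgpCupSpec ∧
    (firstDatumOfRecord R S (C.temperedArithmeticGroup e) φ hφ (C.thetaEnvData μ hC hS) ιX hY (ThetaCoord.thetaStub (lv : ℕ)) odd_l K'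
        constEmb₀ constEmb₀_injective).SgpCapSection ∧
    (firstDatumOfRecord R S (C.temperedArithmeticGroup e) φ hφ (C.thetaEnvData μ hC hS) ιX hY (ThetaCoord.thetaStub (lv : ℕ)) odd_l K'
        constEmb₀ constEmb₀_injective).AutAmpleBN ∧
    (firstDatumOfRecord R S (C.temperedArithmeticGroup e) φ hφ (C.thetaEnvData μ hC hS) ιX hY (ThetaCoord.thetaStub (lv : ℕ)) odd_l K'
        constEmb₀ constEmb₀_injective).BiKummerDifferenceMem :=
  laws_firstDatumOfRecord R S _ φ hφ _ ιX hY _ odd_l K' constEmb₀ constEmb₀_injective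

variable (hker : φ.toMonoidHom.ker ≤ (ThetaSubquotient.qSub D C.Huu).ker)

set_option maxHeartbeats 400000 in -- as above
/-- **… and with the Setting's OWN theta subquotients `(l·Δ_Θ)_{(-)}` read on the model's base** (`Q := ofSettingSubLift D l Π^tp_X̲̲ φ`, p514054;
DISPLAYED clause `hker`): e.g. `StrvSection` (the other laws likewise, `laws_firstDatumOfRecord`). [cite: MochizukiEtTh2009, §5 p.327 (PDF p.101)] -/
theorem strvSection_firstDatumOfRecord_ofThetaSetting_ofSettingSubLift :
    (firstDatumOfRecord R S (C.temperedArithmeticGroup e) φ hφ (C.thetaEnvData μ hC hS) ιX hY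
        (ThetaSubquotient.ofSettingSubLift D (lv : ℕ) C.Huu φ.toMonoidHom hφ hker) odd_l K' constEmb₀ constEmb₀_injective).StrvSection :=
  (laws_firstDatumOfRecord R S _ φ hφ _ ιX hY _ odd_l K' constEmb₀ constEmb₀_injective).1

include hφ hY odd_l constEmb₀_injective in
/-- **ENTRY THEOREM — THE FIRST §5 DATUM OF RECORD EXISTS AT THE GENUINE `Π^tp_X̲̲` OF A `ThetaSetting`, FIRST FORM:** for every continuous
surjection `φ : Π^tp_X̲̲ ↠ Compat₃′` with `φ₃ ∘ φ ∘ ιX = 1` on `Π^tp_Ÿ̲̲` and every constants datum there IS a §5 datum `𝔉` over the small-index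
tower model with `𝔉.PiX =` the Setting's `Π^tp_X̲̲`-datum group, `𝔉.(l·Δ_Θ)_{(-)} =` the model's `Θ̈`-coordinate stub, prime `l`, Kummer order
`l·N`, satisfying `StrvSection ∧ SgpCapSpec ∧ SgpCupSpec ∧ SgpCapSection ∧ AutAmpleBN ∧ BiKummerDifferenceMem` — NO root, divisor or `hH`
hypothesis (`ιX := refl` admissible: `thetaEnvData_PiX_eq_temperedArithmeticGroup_Pi`, this seat's `Sec5FirstDatumThetaTwistTowerSmallIndex`).
[cite: MochizukiEtTh2009, Prop 5.2 (i) p.324 (PDF p.98); §5 p.330–331 (PDF pp.104–105)] -/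
theorem exists_thetaFrobenioid_firstForm_ofThetaSetting :
    ∃ 𝔉 : ThetaFrobenioid.{0} (settingSmallYdd R S (C.temperedArithmeticGroup e) φ hφ (fun _ _ _ => True) (C.thetaEnvData μ hC hS) ιX).C
        (ConnectedPart (BTemp (Compat 3 thetaShear))),
      𝔉.PiX = (C.thetaEnvData μ hC hS).PiX ∧ (∀ E, 𝔉.lDelta E = (ThetaCoord.thetaStub (lv : ℕ)).lDelta E) ∧ 𝔉.l = lv ∧ 𝔉.N = lv * N ∧
      𝔉.StrvSection ∧ 𝔉.SgpCapSpec ∧ 𝔉.SgpCupSpec ∧ 𝔉.SgpCapSection ∧ 𝔉.AutAmpleBN ∧ 𝔉.BiKummerDifferenceMem :=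
  ⟨firstDatumOfRecord R S (C.temperedArithmeticGroup e) φ hφ (C.thetaEnvData μ hC hS) ιX hY (ThetaCoord.thetaStub (lv : ℕ)) odd_l K'
      constEmb₀ constEmb₀_injective,
    rfl, fun _ => rfl, rfl, rfl,
    laws_firstDatumOfRecord_ofThetaSetting_thetaStub R S C e μ hC hS φ hφ ιX hY odd_l K' constEmb₀ constEmb₀_injective⟩

end OfThetaSetting

/-! ## §C Bridge to abc-iut-L2-t3's first-form instance (p519901) — v2, append-only -/

section Bridge
variable (R S : ((ConnectedPart (BTemp (Compat 3 thetaShear)))ᵒᵖ ⥤ CommMonCat.{0}) → Prop)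
  {K : Type} [Field K] (X : SemiGraphs.TemperedArithmeticGroup.{0} K) (φ : X.Pi →ₜ* Compat 3 thetaShear)
  (hφ : Function.Surjective φ) {lv N : ℕ+} (T : ThetaEnvData.{0} (lv * N)) (ιX : T.PiX ≃ₜ* X.Pi)
  (hY : ∀ y : T.PiX, y ∈ T.PiYdd → φ₃ (φ (ιX y)) = 1)
  (Q : FrobenioidTheta.ThetaSubquotientStub.{0} (ConnectedPart (BTemp (Compat 3 thetaShear))))
  {pullFrac : ∀ {A A' : (settingSmallYdd R S X φ hφ (fun _ _ _ => True) T ιX).C} (_ : A' ⟶ A),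
    (settingSmallYdd R S X φ hφ (fun _ _ _ => True) T ιX).biratUnits A →
      (settingSmallYdd R S X φ hφ (fun _ _ _ => True) T ιX).biratUnits A'}
  (Rt : ThetaProperRootYdd R S X φ hφ T ιX hY (lv * N) pullFrac)
  (odd_l : Odd (lv : ℕ)) (K' : Type) [Field K'] (constEmb : K'ˣ →* (temperedFrobenioidSmall R S).biratUnitsModel Rt.BN)
  (constEmb_injective : Injective constEmb)
set_option maxHeartbeats 800000 in -- ELABORATION NOTE of §A (explicit implicits; the two `def`s meet once)
/-- **`firstDatumFF` IS abc-iut-L2-t3's `ofQuotientTemperoidDataFirstForm` (p519901) at the `Ÿ`-anchor datum**, definitionally (both are the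
core at `(Θ̈, (s′, s″), l·N)`) — its lemmas apply to the datum of record by name. [cite: MochizukiEtTh2009, Prop 5.2 (i) p.324 (PDF p.98)] -/
theorem firstDatumFF_eq_firstForm :
    firstDatumFF R S X φ hφ T ιX hY Q Rt odd_l K' constEmb constEmb_injective =
      ThetaFrobenioid.ofQuotientTemperoidDataFirstForm (X := X) (hG := isTempered_compat₃') (φ := φ) (hφ := hφ)
        (tf := temperedFrobenioidSmall R S) (hZ := rfl) (hP := hPSmall R S) (NH := fun _ _ _ => True)
        (A₀ := (temperedFrobenioidSmall R S).quotConnZeroObj isTempered_compat₃'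
          (BiKummerSetting.yddImage X φ hφ T ιX (isOpen_yddImage_compat₃ X φ hφ T ιX)))
        (hA₀ := (temperedFrobenioidSmall R S).isFrobeniusTrivial_quotConnZeroObj isTempered_compat₃'
          (BiKummerSetting.yddImage X φ hφ T ιX (isOpen_yddImage_compat₃ X φ hφ T ιX)))
        (hA₀' := (temperedFrobenioidSmall R S).isGaloisObj_quotConnZeroObj_base isTempered_compat₃'
          (BiKummerSetting.yddImage X φ hφ T ιX (isOpen_yddImage_compat₃ X φ hφ T ιX)))
        (pullFrac := pullFrac) (T := T) (θ := thetaProperUnitYdd R S X φ hφ (fun _ _ _ => True) T ιX hY)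
        (hypotheses_temperedFrobenioidSmall R S) Q odd_l Rt ιX K' constEmb constEmb_injective
        (hinvc_thetaProperRootYdd R S X (fun _ _ _ => True) φ hφ T ιX hY Rt)
        (hinvp_thetaProperRootYdd R S X (fun _ _ _ => True) φ hφ T ιX hY Rt) := rfl

set_option maxHeartbeats 800000 in
/-- **`Facts ⟸ hK` via abc-iut-L2-t3's `facts_ofQuotientTemperoidDataFirstForm` BY NAME** (`hH := hH_settingSmallYdd`). [cite: MochizukiEtTh2009, §5 p.331 (PDF p.105)] -/
theorem facts_firstDatumFF_byName
    (hK : (firstDatumFF R S X φ hφ T ιX hY Q Rt odd_l K' constEmb constEmb_injective).ConstantsActByCyclotome) :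
    (firstDatumFF R S X φ hφ T ιX hY Q Rt odd_l K' constEmb constEmb_injective).Facts := by
  rw [firstDatumFF_eq_firstForm] at hK ⊢
  exact ThetaFrobenioid.facts_ofQuotientTemperoidDataFirstForm _ _ _ _ _ _ _ _ _ _
    (hH_settingSmallYdd R S X φ hφ (fun _ _ _ => True) T ιX) hK

end Bridge
end ThetaTwistTowerSmallIndex

end Literature.AnabelianGeometry.EtaleTheta

end
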